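import Summits.CriticalPhenomena.Ising3D.ExclusionSentencesControl2DRecognised
import Summits.CriticalPhenomena.Ising3D.ExclusionSentencesControl2DCAlg
import Summits.CriticalPhenomena.Ising3D.ExclusionSentencesControl2DCLin
import Summits.CriticalPhenomena.Ising3D.ExclusionSentencesControl2DTrgGammaC7Fin

/-!
# Exclusion sentences — the 2D control's third datum `c = 1/2` RECOGNISED in the kernel
(cell `pub-ising3x`, seat recog-1, gen 6)

HONEST FRAMING: lottery ticket; floor = tightest certified 3D Ising CFT bounds; no exact-solution
claim without a proof.

Companion of `ExclusionSentencesControl2DRecognised.lean` (`Δ_σ = 1/8` at 8 digits, `Δ_ε = 1` at 6 digits) for the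
Virasoro central charge `c = 1/2` (SCOPE.md §4: recognised blind at 5 certified digits in round R2 under rule C).
FAMILIES-v1 applies to kind `c`: `RAT`, `KAC` (the table's central charges `1 − 6(p′−p)²/(pp′)`, `p′ ≤ 24`), `KACX`
(`N = 1`, `W₃`, `SU(2)_k`, `ℤ_k` central charges), `ALG`, `LIN`, `TRG` — NOT `NAMED` (kind `Delta` only; its
series-era value `Δ_σ = 1/2` is a dimension, not a central charge).

* `control2D_c_recognised` — **`c^{2D} = 1/2` is recognised by the kernel at 7 certified digits**: a real within
  `10⁻⁷` of `1/2` that is a rational of denominator `≤ 10⁶`, a KAC or KACX central charge, a real algebraic number of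
  degree `d ≤ 6` within the table height, a LIN form of height `≤ 12` or a TRG monomial (`D ≤ 17`, `h ≤ 32`) IS `1/2`.
  Not at 6 digits: within `10⁻⁶` the LIN table still has 8 members and the TRG table 2
  (`(29/17)·√2·Γ(¼)/π^{5/2}`, `(32/19)·√π·ζ(3)/Γ(⅓)²`) — Python twins `tools/trglin_exceptions.py`,
  `tools/trg_gamma_exceptions.py`; at `10⁻⁷` both are EMPTY in the kernel (`control_c7_not_lin`, `control_c7_not_trgFull`).
* non-vacuity: `1/2` IS a catalogue member (`half_mem_cKacFamily`; the rational `1/2`).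

So the kernel's answer to §4's "at which certified precision is each 2D datum recognised against the whole frozen
catalogue": `Δ_σ = 1/8` at 8, `Δ_ε = 1` at 6, `c = 1/2` at 7 certified digits (the protocol's rule C, which never
accepts LIN/TRG members, recognised all three at 5–6).  No 3D digit is used anywhere.
-/

namespace Summit.CriticalPhenomena.Ising3D

/-- A rational of denominator `≤ 10⁶` within `10⁻⁷` of `1/2` IS `1/2` (`|r − 1/2| ≥ 1/(2·r.den) ≥ 5·10⁻⁷` otherwise). -/
theorem control_c7_rat_unique {x : ℝ}
    (hx : ((1 / 2 - 1 / 10 ^ 7 : ℚ) : ℝ) ≤ x ∧ x ≤ ((1 / 2 + 1 / 10 ^ 7 : ℚ) : ℝ)) (r : ℚ) (hden : r.den ≤ 10 ^ 6)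
    (hxr : x = (r : ℝ)) : r = 1 / 2 := by
  subst hxr
  have h1 : (1 / 2 - 1 / 10 ^ 7 : ℚ) ≤ r := by exact_mod_cast hx.1
  have h2 : r ≤ (1 / 2 + 1 / 10 ^ 7 : ℚ) := by exact_mod_cast hx.2
  refine rat_eq_of_den_le_of_abs_sub_lt hden ?_
  have hd : (1 / 2 : ℚ).den = 2 := by decide +kernel
  rw [hd, abs_sub_lt_iff]
  push_cast
  constructor <;> linarith

/-- **`c^{2D} = 1/2` RECOGNISED in the kernel at 7 certified digits** against every FAMILIES-v1 family of kind `c`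
at the table bounds (rationals cut at denominator `10⁶`). -/
theorem control2D_c_recognised {x : ℝ}
    (hx : ((1 / 2 - 1 / 10 ^ 7 : ℚ) : ℝ) ≤ x ∧ x ≤ ((1 / 2 + 1 / 10 ^ 7 : ℚ) : ℝ))
    (hcat : (∃ r : ℚ, r.den ≤ 10 ^ 6 ∧ x = (r : ℝ)) ∨ (∃ v ∈ cKacFamily 24, x = (v : ℝ)) ∨
      (∃ v ∈ cKacxFamily, x = (v : ℝ)) ∨ (∃ d H : ℕ, (d, H) ∈ algTable ∧ x ∈ algFamily d H) ∨
      x ∈ linFamily 12 ∨ x ∈ trgFullFamily 17 32) :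
    x = 1 / 2 := by
  have hx5 : ((1 / 2 - 1 / 10 ^ 5 : ℚ) : ℝ) ≤ x ∧ x ≤ ((1 / 2 + 1 / 10 ^ 5 : ℚ) : ℝ) := by
    obtain ⟨h1, h2⟩ := hx
    push_cast at h1 h2 ⊢
    constructor <;> linarith
  rcases hcat with ⟨r, hden, hxr⟩ | ⟨v, hv, hxv⟩ | ⟨v, hv, hxv⟩ | ⟨d, H, hdH, hmem⟩ | hm | hm
  · rw [hxr, control_c7_rat_unique hx r hden hxr]; push_cast; ring
  · rw [hxv, control_c_unique hx5 v (Or.inl hv) hxv]; push_cast; ring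
  · rw [hxv, control_c_unique hx5 v (Or.inr hv) hxv]; push_cast; ring
  · exact control_c_alg_unique hx5 hdH hmem
  · exact absurd hm (control_c7_not_lin hx)
  · exact absurd hm (control_c7_not_trgFull hx)

/-- Non-vacuity of the positive side: `1/2` itself is a catalogue member in the hypothesis shape of
`control2D_c_recognised` (a rational of denominator `2`, and the Kac central charge `c(M(3,4))`). -/
theorem control2D_c_recognised_nonvacuous :
    (∃ r : ℚ, r.den ≤ 10 ^ 6 ∧ ((1 : ℝ) / 2) = (r : ℝ)) ∧ (∃ v ∈ cKacFamily 24, ((1 : ℝ) / 2) = (v : ℝ)) :=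
  ⟨⟨1 / 2, by decide +kernel, by push_cast; ring⟩, ⟨1 / 2, half_mem_cKacFamily, by push_cast; ring⟩⟩

end Summit.CriticalPhenomena.Ising3D
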